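import Summits.BirchSwinnertonDyer.Rank1Residual.Additive.X3BranchKummerLayerUnits
import HarnessLib

/-!
# X3, the DEGENERATE rows OFF the sub-locus: the class of a PRODUCT of layer-one units lies in GV's `U`
# (cell `bsd-eis`, seat `bsd-eis-x3` gen 7; sequel of `X3BranchKummerLayerUnits.lean` — the same
# conjugation argument for `∏ β_i^{k_i}`; route K1 `AdditiveBranchIMC`, crux `GordTwoRankZeroOffCaseOne`
# — supports only)

HONEST FRAMING (cell `bsd-eis`, `run/shared/lean/pub/bsd-eis/README.md` §4): the programme's target of
record is the full Birch–Swinnerton-Dyer formula for every `E/ℚ` of analytic rank `≤ 1`; this file is a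
step of the U-side LOWER BOUND of the degenerate certificate road on the rows with a prime
`ℓ ≡ ±1 (mod 9)` in `Σ₀` (x3-MEMO-9 §2.4 (e)). THEOREMS ONLY (no `def`, no named fact, no `sorry`);
nothing is booked; no label, tier or count of record moves.

* `rel_sum_at` — Kummer relations combine over a product (gen 6's `rel_sum`, one `σ` at a time).
* `kummerSumClass_mem_unramifiedSelmer` — for units `a_i = P_i(θ)` of `ℚ_1` with conjugate,
  norm and cube data as in `kummerClass_mem_unramifiedSelmer`, cube roots `β_i`, exponents `k_i`, and
  a cocycle `F` on `ker κ` with `F(h) = m_h y₀`, `h·∏β_i^{k_i} = ζ₃^{m_h}∏β_i^{k_i}`: `[F] ∈ U`. For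
  `τ ∈ Γ_ℚ` the conjugate `conj_τ[F]` is the class of the sum of the Kummer cocycles of the `τa_i`
  w.r.t. `τβ_i` (`conjH1_eq_of_kummer` for the product), equally w.r.t. the GOOD roots of the
  conjugates (`class_eq_of_root_mul_pow`, the product changing by a power of `ζ₃`), and that sum
  vanishes on `I_v ∩ ker κ` for every `v ∉ Σ₀` and `v ∣ 3`.

References: [GreenbergVatsal2000] §2 pp. 28–30; [SerreLocalFields1979] Ch. X §3; [Washington1997]
§13.1; cell file `run/shared/lean/pub/bsd-eis/x3-MEMO-9.md` §2.4 (e).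
-/

set_option autoImplicit false

noncomputable section

open scoped Classical AddSubgroup NumberField

namespace Summit.BirchSwinnertonDyer.Rank1Residual.Additive

open NumberField IsDedekindDomain Field WeierstrassCurve Polynomial
  Literature.NumberTheory.GaloisRepresentations
  Literature.NumberTheory.EllipticCurves
  Literature.NumberTheory.EllipticCurves.GreenbergSelmer
  Literature.NumberTheory.EllipticCurves.GreenbergVatsal2000
  Literature.NumberTheory.EllipticCurves.Rank1Residual
  Literature.NumberTheory.NumberFields
  Summit.BirchSwinnertonDyer.Rank1Residual.X2.ResidualDevissageModules
  Summit.BirchSwinnertonDyer.Rank1Residual.X2.ResidualDevissageLine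
  Summit.BirchSwinnertonDyer.Rank1Residual.Iwasawa.CyclotomicLayerOne
  KummerLineClasses KummerLayerClasses

namespace KummerLayerClasses

variable {Ψ : Type} [AddCommGroup Ψ] [DistribMulAction (absoluteGaloisGroup ℚ) Ψ]

omit [DistribMulAction (absoluteGaloisGroup ℚ) Ψ] in
/-- **Kummer relations combine** (as gen 6's `rel_sum`, the relation being asked at one `σ` only):
if `σβ_i = ζ^{n}β_i ∧ f_i(σ) = n·y₀` for each `i ∈ s`, then the same holds for `∏ β_i^{k_i}` and
`Σ k_i f_i`. [folklore] -/
theorem rel_sum_at {ι : Type*} (s : Finset ι) {ζ : AlgebraicClosure ℚ} (y₀ : Ψ)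
    (β : ι → AlgebraicClosure ℚ) (f : ι → absoluteGaloisGroup ℚ → Ψ) (σ : absoluteGaloisGroup ℚ)
    (hrel : ∀ i ∈ s, ∃ n : ℕ, σ • β i = ζ ^ n * β i ∧ f i σ = n • y₀) (k : ι → ℕ) :
    ∃ n : ℕ, σ • (∏ i ∈ s, β i ^ k i) = ζ ^ n * ∏ i ∈ s, β i ^ k i ∧
      (∑ i ∈ s, k i • f i σ) = n • y₀ := by
  induction s using Finset.cons_induction with
  | empty => exact ⟨0, by simp, by simp⟩
  | cons a s ha ih =>
    obtain ⟨m, hm1, hm2⟩ := ih fun i hi ↦ hrel i (Finset.mem_cons_of_mem hi)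
    obtain ⟨n, hn1, hn2⟩ := hrel a (Finset.mem_cons_self a s)
    refine ⟨k a * n + m, ?_, ?_⟩
    · rw [Finset.prod_cons, smul_mul', smul_pow', hn1, hm1, mul_pow, ← pow_mul, pow_add]
      ring
    · rw [Finset.sum_cons, hn2, hm2, add_nsmul, mul_nsmul']

/-- **The class of a product of layer-one units lies in `U`.** `κ` cyclotomic, `Ψ` a discrete
`ω`-line with `3·y₀ = 0`, `θ = ζ + ζ⁸`; units `a_i = P_i⁽⁰⁾(θ)` with conjugates `P_i⁽¹⁾(θ)`,
`P_i⁽²⁾(θ)`, cube certificates for all conjugates, norms `n_i` supported on `Σ₀`; cube roots `β_i` of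
the `a_i`, exponents `k_i`; `F` a cocycle on `ker κ` with `F(h) = m_h·y₀`,
`h·∏β_i^{k_i} = (ζ³)^{m_h}∏β_i^{k_i}`. Then `[F] ∈ unramifiedSelmer (ker κ) Ψ 3 Σ₀`.
[cite: GreenbergVatsal2000, §2 pp. 28–29] [cite: SerreLocalFields1979, Ch. X §3] -/
theorem kummerSumClass_mem_unramifiedSelmer [hp : Fact (Nat.Prime 3)] (κ : ZpExtension ℚ 3)
    (hκ : κ.IsCyclotomic) (S₀ : Finset (HeightOneSpectrum (𝓞 ℚ)))
    [TopologicalSpace Ψ] [DiscreteTopology Ψ]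
    (hΨ : ∀ (σ : absoluteGaloisGroup ℚ) (y : Ψ),
      σ • y = ((modNCyclotomicCharacter ℚ 3 σ : (ZMod 3)ˣ) : ZMod 3).val • y)
    {y₀ : Ψ} (hy₀3 : 3 • y₀ = 0) {ζ : AlgebraicClosure ℚ} (hζ : IsPrimitiveRoot ζ 9)
    {ι : Type} [Fintype ι] (P : ι → Fin 3 → Fin 3 → ℤ)
    (hconj1 : ∀ i, (P i 0 0 : AlgebraicClosure ℚ) + P i 0 1 * ((ζ + ζ ^ 8) ^ 2 - 2) +
      P i 0 2 * ((ζ + ζ ^ 8) ^ 2 - 2) ^ 2 =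
      (P i 1 0 : AlgebraicClosure ℚ) + P i 1 1 * (ζ + ζ ^ 8) + P i 1 2 * (ζ + ζ ^ 8) ^ 2)
    (hconj2 : ∀ i, (P i 0 0 : AlgebraicClosure ℚ) + P i 0 1 * (-(ζ + ζ ^ 8) ^ 2 - (ζ + ζ ^ 8) + 2) +
      P i 0 2 * (-(ζ + ζ ^ 8) ^ 2 - (ζ + ζ ^ 8) + 2) ^ 2 =
      (P i 2 0 : AlgebraicClosure ℚ) + P i 2 1 * (ζ + ζ ^ 8) + P i 2 2 * (ζ + ζ ^ 8) ^ 2)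
    (D T : ι → Fin 3 → Fin 3 → ℤ)
    (hcube : ∀ i j, ((P i j 0 : AlgebraicClosure ℚ) + P i j 1 * (ζ + ζ ^ 8) + P i j 2 * (ζ + ζ ^ 8) ^ 2) *
      ((D i j 0 : AlgebraicClosure ℚ) + D i j 1 * (ζ + ζ ^ 8) + D i j 2 * (ζ + ζ ^ 8) ^ 2) ^ 3 =
      1 + 9 * ((T i j 0 : AlgebraicClosure ℚ) + T i j 1 * (ζ + ζ ^ 8) + T i j 2 * (ζ + ζ ^ 8) ^ 2))
    (n : ι → ℕ) (hn0 : ∀ i, n i ≠ 0)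
    (hnorm : ∀ i, ((P i 0 0 : AlgebraicClosure ℚ) + P i 0 1 * (ζ + ζ ^ 8) + P i 0 2 * (ζ + ζ ^ 8) ^ 2) *
      (((P i 1 0 : AlgebraicClosure ℚ) + P i 1 1 * (ζ + ζ ^ 8) + P i 1 2 * (ζ + ζ ^ 8) ^ 2) *
        ((P i 2 0 : AlgebraicClosure ℚ) + P i 2 1 * (ζ + ζ ^ 8) + P i 2 2 * (ζ + ζ ^ 8) ^ 2)) = n i)
    (hnS : ∀ i (v : HeightOneSpectrum (𝓞 ℚ)), ((n i : ℕ) : 𝓞 ℚ) ∈ v.asIdeal → v ∈ S₀)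
    (β : ι → AlgebraicClosure ℚ)
    (hβ' : ∀ i, β i ^ 3 = (P i 0 0 : AlgebraicClosure ℚ) + P i 0 1 * (ζ + ζ ^ 8) + P i 0 2 * (ζ + ζ ^ 8) ^ 2)
    (k : ι → ℕ) (F : contOneCocycles (discreteTopRep κ.kerSubgroup Ψ))
    (hF : ∀ h : κ.kerSubgroup, ∃ m : ℕ, (h : absoluteGaloisGroup ℚ) • (∏ i, β i ^ k i) =
      (ζ ^ 3) ^ m * ∏ i, β i ^ k i ∧ F.1 h = m • y₀) :
    oneCocycleClass (discreteTopRep κ.kerSubgroup Ψ) F ∈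
      unramifiedSelmer κ.kerSubgroup Ψ 3 (↑S₀ : Set (HeightOneSpectrum (𝓞 ℚ))) := by
  haveI : NeZero ((3 : ℕ) : ℚ) := ⟨by norm_num⟩
  set θ : AlgebraicClosure ℚ := ζ + ζ ^ 8 with hθdef
  have hθ : θ ^ 3 = 3 * θ - 1 := by linear_combination theta_cubic hζ
  have hζ₃ : IsPrimitiveRoot (ζ ^ 3) 3 := hζ.pow (by norm_num) (by norm_num)
  have hkerθ : ∀ σ ∈ κ.kerSubgroup, σ • θ = θ := by
    intro σ hσ
    have hmem := zeta_add_pow_mem_layer_one hκ ζ hζ.pow_eq_one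
    rw [ZpExtension.layer, IntermediateField.mem_fixedField_iff] at hmem
    exact hmem _ (Subgroup.mem_map.mpr ⟨σ, κ.kerSubgroup_le_layerSubgroup 1 hσ, rfl⟩)
  set a : ι → AlgebraicClosure ℚ := fun i ↦ (P i 0 0 : AlgebraicClosure ℚ) + P i 0 1 * θ + P i 0 2 * θ ^ 2
    with hadef
  have hβa : ∀ i, β i ^ 3 = a i := fun i ↦ hβ' i
  have ha0 : ∀ i, a i ≠ 0 := fun i h0 ↦ hn0 i (by
    have := hnorm i
    rw [show ((P i 0 0 : AlgebraicClosure ℚ) + P i 0 1 * (ζ + ζ ^ 8) + P i 0 2 * (ζ + ζ ^ 8) ^ 2) = a i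
      from rfl, h0, zero_mul] at this
    exact_mod_cast this.symm)
  have hβ0 : ∀ i, β i ≠ 0 := fun i h0 ↦ by
    have := hβa i; rw [h0, zero_pow three_ne_zero] at this; exact ha0 i this.symm
  refine mem_unramifiedSelmer_of_conj_of_mem κ.kerSubgroup 3 F (↑S₀) fun τ ↦ ?_
  -- which conjugate: `τθ ∈ {θ, θ²−2, −θ²−θ+2}` picks `j` with `τ a_i = P_i⁽ʲ⁾(θ)` for all `i`
  obtain ⟨j, hτa, hcof⟩ : ∃ j : Fin 3,
      (∀ i, τ • a i = (P i j 0 : AlgebraicClosure ℚ) + P i j 1 * θ + P i j 2 * θ ^ 2) ∧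
      (∀ i, ∃ b : AlgebraicClosure ℚ, IsIntegral (𝓞 ℚ) b ∧
        ((P i j 0 : AlgebraicClosure ℚ) + P i j 1 * θ + P i j 2 * θ ^ 2) * b = n i) := by
    rcases smul_theta_mem_roots hθ τ with hτθ | hτθ | hτθ
    · refine ⟨0, fun i ↦ ?_, fun i ↦ ⟨_, (isIntegral_eval_theta hθ _ _ _).mul
        (isIntegral_eval_theta hθ _ _ _), hnorm i⟩⟩
      change τ • ((P i 0 0 : AlgebraicClosure ℚ) + P i 0 1 * θ + P i 0 2 * θ ^ 2) = _
      rw [smul_eval_theta, hτθ]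
    · refine ⟨1, fun i ↦ ?_, fun i ↦ ⟨_, (isIntegral_eval_theta hθ (P i 0 0) (P i 0 1) (P i 0 2)).mul
        (isIntegral_eval_theta hθ (P i 2 0) (P i 2 1) (P i 2 2)), ?_⟩⟩
      · change τ • ((P i 0 0 : AlgebraicClosure ℚ) + P i 0 1 * θ + P i 0 2 * θ ^ 2) = _
        rw [smul_eval_theta, hτθ]; exact hconj1 i
      · rw [← hnorm i]; ring
    · refine ⟨2, fun i ↦ ?_, fun i ↦ ⟨_, (isIntegral_eval_theta hθ (P i 0 0) (P i 0 1) (P i 0 2)).mul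
        (isIntegral_eval_theta hθ (P i 1 0) (P i 1 1) (P i 1 2)), ?_⟩⟩
      · change τ • ((P i 0 0 : AlgebraicClosure ℚ) + P i 0 1 * θ + P i 0 2 * θ ^ 2) = _
        rw [smul_eval_theta, hτθ]; exact hconj2 i
      · rw [← hnorm i]; ring
  -- good roots of the conjugates
  choose βτ hβτ hβτfix using fun i ↦ exists_goodRoot hθ (P i j) (D i j) (T i j) (hcube i j)
  have hτβ3 : ∀ i, (τ • β i) ^ 3 = τ • a i := fun i ↦ by rw [← smul_pow', hβa i]
  have hτa0 : ∀ i, τ • a i ≠ 0 := fun i h0 ↦ by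
    obtain ⟨b, -, hb⟩ := hcof i
    rw [← hτa i, h0, zero_mul] at hb
    exact hn0 i (by exact_mod_cast hb.symm)
  have hτβ0 : ∀ i, τ • β i ≠ 0 := fun i h0 ↦ by
    have := hτβ3 i; rw [h0, zero_pow three_ne_zero] at this; exact hτa0 i this.symm
  have hβτ' : ∀ i, βτ i ^ 3 = τ • a i := fun i ↦ by rw [hτa i]; exact hβτ i
  have hjj : ∀ i, ∃ jj : ℕ, βτ i = (ζ ^ 3) ^ jj * (τ • β i) := fun i ↦ by
    have hq' : (βτ i / (τ • β i)) ^ 3 = 1 := by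
      rw [div_pow, hβτ' i, ← hτβ3 i, div_self (pow_ne_zero _ (hτβ0 i))]
    obtain ⟨jj, -, hζj⟩ := hζ₃.eq_pow_of_pow_eq_one hq'
    exact ⟨jj, by rw [hζj, div_mul_cancel₀ _ (hτβ0 i)]⟩
  choose jj hjj using hjj
  have hβτ0 : ∀ i, βτ i ≠ 0 := fun i ↦ by
    rw [hjj i]; exact mul_ne_zero (pow_ne_zero _ (hζ₃.ne_zero three_ne_zero)) (hτβ0 i)
  -- `ker κ` fixes `τ a_i`
  have hkerτa : ∀ i, ∀ σ ∈ κ.kerSubgroup, σ • (τ • a i) = τ • a i := fun i σ hσ ↦ by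
    rw [hτa i, smul_eval_theta, hkerθ σ hσ]
  -- Kummer cocycles of `τ a_i` w.r.t. the good roots and w.r.t. `τβ_i`
  choose fτ hfτc hfτcoc hfτrel using fun i ↦
    exists_kummerCocycle (p := 3) κ.kerSubgroup hΨ y₀ hy₀3 hζ₃ (hτa0 i) (hkerτa i) (hβτ' i)
  choose f₁ hf₁c hf₁coc hf₁rel using fun i ↦
    exists_kummerCocycle (p := 3) κ.kerSubgroup hΨ y₀ hy₀3 hζ₃ (hτa0 i) (hkerτa i) (hτβ3 i)
  -- the summed conjugate cocycles
  set Fτ : absoluteGaloisGroup ℚ → Ψ := fun σ ↦ ∑ i, k i • fτ i σ with hFτdef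
  set F₁ : absoluteGaloisGroup ℚ → Ψ := fun σ ↦ ∑ i, k i • f₁ i σ with hF₁def
  have hFτc' : Continuous Fτ := continuous_finsetSum _ fun i _ ↦ (continuous_nsmul (k i)).comp (hfτc i)
  have hF₁c' : Continuous F₁ := continuous_finsetSum _ fun i _ ↦ (continuous_nsmul (k i)).comp (hf₁c i)
  have hFτcoc' : ∀ σ ∈ κ.kerSubgroup, ∀ σ' ∈ κ.kerSubgroup, Fτ (σ * σ') = Fτ σ + σ • Fτ σ' :=
    fun σ hσ σ' hσ' ↦ by
      simp only [hFτdef, hfτcoc _ σ hσ σ' hσ', nsmul_add, Finset.sum_add_distrib, Finset.smul_sum, smul_comm σ]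
  have hF₁coc' : ∀ σ ∈ κ.kerSubgroup, ∀ σ' ∈ κ.kerSubgroup, F₁ (σ * σ') = F₁ σ + σ • F₁ σ' :=
    fun σ hσ σ' hσ' ↦ by
      simp only [hF₁def, hf₁coc _ σ hσ σ' hσ', nsmul_add, Finset.sum_add_distrib, Finset.smul_sum, smul_comm σ]
  obtain ⟨Fτc, -, hFτc1, -⟩ := exists_class_of_cocycle κ.kerSubgroup le_rfl Fτ hFτc' hFτcoc'
  obtain ⟨F₁c, -, hF₁c1, -⟩ := exists_class_of_cocycle κ.kerSubgroup le_rfl F₁ hF₁c' hF₁coc'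
  -- the products `B = ∏ β_i^{k_i}`, `τB`, `∏ βτ_i^{k_i} = ζ₃^J τB`
  set B : AlgebraicClosure ℚ := ∏ i, β i ^ k i with hBdef
  have hB0 : B ≠ 0 := Finset.prod_ne_zero_iff.mpr fun i _ ↦ pow_ne_zero _ (hβ0 i)
  have hτB : τ • B = ∏ i, (τ • β i) ^ k i := by
    rw [hBdef, Finset.smul_prod']
    exact Finset.prod_congr rfl fun i _ ↦ smul_pow' _ _ _
  have hτB0 : τ • B ≠ 0 := by
    rw [hτB]; exact Finset.prod_ne_zero_iff.mpr fun i _ ↦ pow_ne_zero _ (hτβ0 i)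
  set J : ℕ := ∑ i, jj i * k i with hJ
  have hprodτ : ∏ i, βτ i ^ k i = (ζ ^ 3) ^ J * (τ • B) := by
    rw [hτB, hJ, ← Finset.prod_pow_eq_pow_sum, ← Finset.prod_mul_distrib]
    exact Finset.prod_congr rfl fun i _ ↦ by rw [hjj i, mul_pow, ← pow_mul]
  refine ⟨Fτ, Fτc, hFτc1, ?_, ?_, ?_⟩
  · -- `conj_τ [F k] = [F₁] = [Fτ]`
    have e1 : conjH1 κ.kerSubgroup Ψ τ
        (oneCocycleClass (discreteTopRep κ.kerSubgroup Ψ) F) =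
        oneCocycleClass (discreteTopRep κ.kerSubgroup Ψ) F₁c :=
      conjH1_eq_of_kummer (p := 3) κ.kerSubgroup hΨ hy₀3 hζ₃ hB0 τ F F₁c hF
        (fun h ↦ by
          obtain ⟨m, hm, hFm⟩ := rel_sum_at Finset.univ y₀ (fun i ↦ τ • β i) f₁ h
            (fun i _ ↦ hf₁rel i h h.2) (fun i ↦ k i)
          refine ⟨m, by rw [hτB]; exact hm, by rw [hF₁c1]; exact hFm⟩)
    have e2 : oneCocycleClass (discreteTopRep κ.kerSubgroup Ψ) Fτc =
        oneCocycleClass (discreteTopRep κ.kerSubgroup Ψ) F₁c :=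
      class_eq_of_root_mul_pow (p := 3) κ.kerSubgroup hΨ hy₀3 hζ₃ hτB0 J F₁c Fτc
        (fun h ↦ by
          obtain ⟨m, hm, hFm⟩ := rel_sum_at Finset.univ y₀ (fun i ↦ τ • β i) f₁ h
            (fun i _ ↦ hf₁rel i h h.2) (fun i ↦ k i)
          refine ⟨m, by rw [hτB]; exact hm, by rw [hF₁c1]; exact hFm⟩)
        (fun h ↦ by
          obtain ⟨m, hm, hFm⟩ := rel_sum_at Finset.univ y₀ βτ fτ h
            (fun i _ ↦ hfτrel i h h.2) (fun i ↦ k i)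
          refine ⟨m, by rw [← hprodτ]; exact hm, by rw [hFτc1]; exact hFm⟩)
    rw [e1, e2]
  · -- vanishing of `Fτ` on `I_v ∩ ker κ`, `v ∉ Σ₀`
    intro v hvS σ hσ hσker
    have hvan : ∀ i, fτ i σ = 0 := by
      intro i
      obtain ⟨m, hm, hfm⟩ := hfτrel i σ hσker
      have hfix : σ • βτ i = βτ i := by
        by_cases hv3 : ((3 : ℕ) : 𝓞 ℚ) ∈ v.asIdeal
        · have hvv : v = (Rat.HeightOneSpectrum.primesEquiv (R := 𝓞 ℚ)).symm ⟨3, Nat.prime_three⟩ := by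
            have h1 := (Literature.NumberTheory.Automorphic.BCDT.natCast_mem_asIdeal_iff_primesEquiv_eq v hp.out).mp hv3
            exact Rat.HeightOneSpectrum.primesEquiv.injective
              (by rw [Equiv.apply_symm_apply]; exact Subtype.ext h1)
          rw [hvv] at hσ
          exact hβτfix i σ (inertia_le_decomp _ hσ) (hkerθ σ hσker)
        · obtain ⟨b, hbint, hb⟩ := hcof i
          exact smul_eq_self_of_mem_inertia_of_pow_eq_of_dvd (p := 3) hζ₃
            (by rw [hτa i]; exact isIntegral_eval_theta hθ _ _ _) hbint
            (by rw [hτa i]; exact hb) (hβτ' i) hv3 (fun hnv ↦ hvS (hnS i v hnv)) hσ (hkerτa i σ hσker)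
      rw [hfix] at hm
      have hζm : (ζ ^ 3) ^ m = 1 := by
        have h1 : (ζ ^ 3) ^ m * βτ i = 1 * βτ i := by rw [one_mul]; exact hm.symm
        exact mul_right_cancel₀ (hβτ0 i) h1
      obtain ⟨kk, rfl⟩ := (hζ₃.pow_eq_one_iff_dvd m).mp hζm
      rw [hfm, mul_nsmul, hy₀3, nsmul_zero]
    simp only [hFτdef]
    exact Finset.sum_eq_zero fun i _ ↦ by rw [hvan i, nsmul_zero]
  · -- vanishing of `Fτ` on `I_v ∩ ker κ`, `v ∣ 3`
    intro v hv3 σ hσ hσker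
    have hvv : v = (Rat.HeightOneSpectrum.primesEquiv (R := 𝓞 ℚ)).symm ⟨3, Nat.prime_three⟩ := by
      have h1 := (Literature.NumberTheory.Automorphic.BCDT.natCast_mem_asIdeal_iff_primesEquiv_eq v hp.out).mp hv3
      exact Rat.HeightOneSpectrum.primesEquiv.injective
        (by rw [Equiv.apply_symm_apply]; exact Subtype.ext h1)
    rw [hvv] at hσ
    have hvan : ∀ i, fτ i σ = 0 := by
      intro i
      obtain ⟨m, hm, hfm⟩ := hfτrel i σ hσker
      rw [hβτfix i σ (inertia_le_decomp _ hσ) (hkerθ σ hσker)] at hm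
      have hζm : (ζ ^ 3) ^ m = 1 := by
        have h1 : (ζ ^ 3) ^ m * βτ i = 1 * βτ i := by rw [one_mul]; exact hm.symm
        exact mul_right_cancel₀ (hβτ0 i) h1
      obtain ⟨kk, rfl⟩ := (hζ₃.pow_eq_one_iff_dvd m).mp hζm
      rw [hfm, mul_nsmul, hy₀3, nsmul_zero]
    simp only [hFτdef]
    exact Finset.sum_eq_zero fun i _ ↦ by rw [hvan i, nsmul_zero]
end KummerLayerClasses

end Summit.BirchSwinnertonDyer.Rank1Residual.Additive

end
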